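import Summits.AtomisticToContinuum.FouriersLaw.Theses.CageBudgetFekete
import Summits.AtomisticToContinuum.FouriersLaw.Theorems.EmbeddedDrudeMourreMourreDissolutionGibbsMixing
import Literature.MathematicalPhysics.KineticTheory.TransportRegularityOfMixing
import Literature.MathematicalPhysics.KineticTheory.InfiniteChainClusteringTransfer
import Literature.MathematicalPhysics.KineticTheory.InfiniteChainL2Locality
import Literature.MathematicalPhysics.KineticTheory.InfiniteChainGeneratorLipschitz
import Literature.MathematicalPhysics.KineticTheory.InfiniteChainTwoPointContinuity
import Literature.MathematicalPhysics.KineticTheory.InfiniteChainSeveredGibbs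
import Literature.MathematicalPhysics.KineticTheory.InfiniteChainGibbsInvariance
import Literature.MathematicalPhysics.KineticTheory.InfiniteChainShiftInvariantUniqueness
import Literature.MathematicalPhysics.KineticTheory.InfiniteChainPartialMomentumReversal
import Literature.MathematicalPhysics.KineticTheory.InfiniteChainCurrentMoments
import Literature.MathematicalPhysics.KineticTheory.InfiniteChainCorrelationContinuity
import Literature.MathematicalPhysics.KineticTheory.InfiniteChainCurrentPositiveType
import Literature.MathematicalPhysics.KineticTheory.InfiniteChainSuperstableOrbits
import HarnessLib

/-!
# `CageBudgetFekete.HeatVarianceCalculus` — PROVED (item stmt-AtomisticToContinuum-15772, route CageBudgetFekete)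

Complete sorry-free proof of the route item
`Summit.AtomisticToContinuum.FouriersLaw.Theses.CageBudgetFekete.HeatVarianceCalculus` (infinite-volume calculus of
the heat variance for EVERY guarded pair `(μ_T, D)` of the pinned anharmonic chain), assembled by the crux
strategist from the line `canonical-rigidity` (`Cruxes/HeatVarianceCalculus/Lines/canonical_rigidity.lean`) and the
proofs of its two registered stubs. Target for a prover (Theorems/ is prover-only):
`Summits/AtomisticToContinuum/FouriersLaw/Theorems/CageBudgetFeketeHeatVarianceCalculus.lean`,
`ledger propose --kind proof --target … --file … --workitem stmt-AtomisticToContinuum-15772`.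

## Proof architecture

* **Dynamics rigidity** (`flow_ae_eq_canonical`): every dynamics `D` preserving a shift-invariant DLR state `μ_T`
  coincides `μ_T`-a.e., AT ALL TIMES, with the canonical Buttà–Marchioro dynamics `D♭` of
  `OscillatorChain.exists_bmDynamics` (carrier `bmGood`): superstability of the shift-invariant state
  (`hasSuperstabilityEstimate_of_isShiftInvariant_pinnedChain`) + sup-in-time BM (2.6)
  (`ae_forall_flow_mem_bmGood_pinnedChain`) + the uniqueness field of `D♭`.
* **Canonical clustering majorant** (`canonicalClusteringMajorant`): for `D♭` and every window `|t| ≤ τ`, ONE summable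
  majorant of `x ↦ |∫ j_0 (j_x ∘ φ_t) dμ_T|` — uniqueness of the shift-invariant DLR state
  (`eq_of_isChainGibbsMeasure_of_isShiftInvariant_pinnedChain`) identifies `μ_T` with the exponentially ρ-mixing
  transfer-operator state (`Theorems.MourreDissolution.exists_gibbsState_mixing_pinnedChain`, Jentzsch gap); BM light-cone
  `L²`-locality uniform on windows (`InfiniteChainDynamics.exists_summable_l2_locality`); clustering transfer
  (`InfiniteChainDynamics.exists_summable_majorant_cov_flow`); `Cov = ∫ j_0 (j_x∘φ_t)` by
  `IsChainGibbsMeasure.integral_bondCurrentZ_eq_zero`, `bondCurrentZ_chainShift`, `flow_chainShift_of_eq_id`.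
* **Laplace calculus** (`laplaceHeatVariance`): for continuous bounded `C`, `V(τ) = 2∫_{(0,τ]}(τ-s)C(s)ds` equals
  `W = 2(tF - G)` on `[0,∞)` (`F, G` primitives of `C`, `sC`), `W' = 2F`, `F' = C`; two integrations by parts on
  `(0,∞)` (`integral_Ioi_mul_deriv_eq_deriv_mul`) with `poly × e^{-νt}` integrability/decay.
* **Composition** (`heatVarianceCalculus_of_reduction`): rigidity ⇒ all correlation terms of `D` equal those of `D♭`;
  (a) absolute convergence from the majorant; (b) continuity by the Weierstrass M-test with
  `continuous_integral_bondCurrentZ_mul_flow_pinnedChain`; (c) `V ≥ 0`, `|C| ≤ C(0)` from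
  `currentCorrelation_positiveType_of_carrier_subset_bmGood` for `D♭`; (d) the Laplace lemma with `M = C(0)`.

[cite: ButtaMarchioro2016, §2 Thm 2.1, eq. (2.6) and §3] [cite: Georgii2011, Thm 10.25 and §11.1]
[cite: LanfordLebowitzLieb1977, §4] [cite: BonettoLebowitzReyBellet2000, §7 eq. (37)] [cite: Helfand1960]
-/

noncomputable section

namespace Summit.AtomisticToContinuum.FouriersLaw.Theorems.CageBudgetFeketeHeatVarianceCalculus

open MeasureTheory ProbabilityTheory Filter Set Function Asymptotics intervalIntegral
open scoped Topology BigOperators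
open Literature.MathematicalPhysics.KineticTheory.HeatConduction

/-! ## §1 Laplace calculus (pure real analysis) -/

/-- `d/dt e^{-νt} = -ν e^{-νt}`. [folklore] -/
theorem hasDerivAt_exp_neg_mul (ν t : ℝ) :
    HasDerivAt (fun x : ℝ => Real.exp (-(ν * x))) (-ν * Real.exp (-(ν * t))) t :=
  (((hasDerivAt_id' t).const_mul ν).fun_neg.exp).congr_deriv (by ring)

/-- A continuous function with a polynomial bound on `[0, ∞)` is Laplace-integrable on `(0, ∞)`. [folklore] -/
theorem integrableOn_exp_neg_mul_of_abs_le_pow {g : ℝ → ℝ} (hg : Continuous g) {K : ℝ} {n : ℕ}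
    (hb : ∀ t : ℝ, 0 ≤ t → |g t| ≤ K * t ^ n) {ν : ℝ} (hν : 0 < ν) :
    IntegrableOn (fun t : ℝ => Real.exp (-(ν * t)) * g t) (Ioi 0) := by
  have hcont : ContinuousOn (fun t : ℝ => Real.exp (-(ν * t)) * g t) (Ici 0) :=
    (Continuous.mul (by fun_prop) hg).continuousOn
  have h1 : g =O[atTop] fun t : ℝ => t ^ n := by
    refine IsBigO.of_bound K ?_
    filter_upwards [eventually_ge_atTop (0 : ℝ)] with t ht
    rw [Real.norm_eq_abs, Real.norm_eq_abs, abs_of_nonneg (pow_nonneg ht n)]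
    exact hb t ht
  have h2 : (fun t : ℝ => t ^ n) =o[atTop] fun t : ℝ => Real.exp (ν / 2 * t) :=
    isLittleO_pow_exp_pos_mul_atTop n (half_pos hν)
  have h3 : g =O[atTop] fun t : ℝ => Real.exp (ν / 2 * t) := h1.trans h2.isBigO
  have h4 : (fun t : ℝ => Real.exp (-(ν * t))) =O[atTop] fun t : ℝ => Real.exp (-(ν * t)) :=
    isBigO_refl _ _
  have h5 := h4.mul h3
  have ho : (fun t : ℝ => Real.exp (-(ν * t)) * g t) =O[atTop] fun t : ℝ => Real.exp (-(ν / 2) * t) :=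
    h5.congr_right fun t => by
      rw [← Real.exp_add]
      congr 1
      ring
  exact integrable_of_isBigO_exp_neg (half_pos hν) hcont ho

/-- `e^{-νt} g(t) → 0` at `+∞` under a polynomial bound. [folklore] -/
theorem tendsto_exp_neg_mul_mul_atTop {g : ℝ → ℝ} {K : ℝ} {n : ℕ}
    (hb : ∀ t : ℝ, 0 ≤ t → |g t| ≤ K * t ^ n) {ν : ℝ} (hν : 0 < ν) :
    Tendsto (fun t : ℝ => Real.exp (-(ν * t)) * g t) atTop (𝓝 0) := by
  have h0 : Tendsto (fun t : ℝ => t ^ (n : ℝ) * Real.exp (-ν * t)) atTop (𝓝 0) :=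
    tendsto_rpow_mul_exp_neg_mul_atTop_nhds_zero (n : ℝ) ν hν
  have h1 : Tendsto (fun t : ℝ => K * (t ^ n * Real.exp (-(ν * t)))) atTop (𝓝 0) := by
    have h := h0.const_mul K
    rw [mul_zero] at h
    refine h.congr' ?_
    filter_upwards [eventually_ge_atTop (0 : ℝ)] with t ht
    rw [Real.rpow_natCast, neg_mul]
  refine squeeze_zero_norm' ?_ h1
  filter_upwards [eventually_ge_atTop (0 : ℝ)] with t ht
  rw [norm_mul, Real.norm_eq_abs, Real.norm_eq_abs, abs_of_pos (Real.exp_pos _)]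
  calc Real.exp (-(ν * t)) * |g t| ≤ Real.exp (-(ν * t)) * (K * t ^ n) :=
        mul_le_mul_of_nonneg_left (hb t ht) (Real.exp_pos _).le
    _ = K * (t ^ n * Real.exp (-(ν * t))) := by ring

/-- **Laplace calculus of the doubly integrated correlation** (registered stub `stub_laplaceHeatVariance` of lines `canonical-rigidity`/`birth`, proved): for continuous bounded `C` and `V(τ) = 2∫_{(0,τ]}(τ-s)C(s)ds`, `e^{-νt}C, e^{-νt}V ∈ L¹(0,∞)` and `∫₀^∞e^{-νt}C = (ν²/2)∫₀^∞e^{-νt}V`. [folklore] -/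
theorem laplaceHeatVariance :
    ∀ C : ℝ → ℝ, Continuous C → (∃ M : ℝ, ∀ t : ℝ, |C t| ≤ M) → ∀ V : ℝ → ℝ,
    V = (fun τ : ℝ => 2 * ∫ s in Set.Ioc (0:ℝ) τ, (τ - s) * C s) → ∀ ν : ℝ, 0 < ν →
    MeasureTheory.IntegrableOn (fun t : ℝ => Real.exp (-(ν * t)) * C t) (Set.Ioi 0) ∧
    MeasureTheory.IntegrableOn (fun t : ℝ => Real.exp (-(ν * t)) * V t) (Set.Ioi 0) ∧
    ∫ t in Set.Ioi (0:ℝ), Real.exp (-(ν * t)) * C t =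
      ν ^ 2 / 2 * ∫ t in Set.Ioi (0:ℝ), Real.exp (-(ν * t)) * V t := by
  intro C hC hM V hV ν hν
  obtain ⟨M, hM⟩ := hM
  have hM0 : 0 ≤ M := (abs_nonneg _).trans (hM 0)
  -- the primitives
  set F : ℝ → ℝ := fun t => ∫ s in (0:ℝ)..t, C s with hF
  set G : ℝ → ℝ := fun t => ∫ s in (0:ℝ)..t, s * C s with hG
  set W : ℝ → ℝ := fun t => 2 * (t * F t - G t) with hW
  have hsC : Continuous fun s : ℝ => s * C s := continuous_id.mul hC
  have hFd : ∀ t, HasDerivAt F (C t) t := fun t => (hC.integral_hasStrictDerivAt 0 t).hasDerivAt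
  have hGd : ∀ t, HasDerivAt G (t * C t) t := fun t => (hsC.integral_hasStrictDerivAt 0 t).hasDerivAt
  have hWd : ∀ t, HasDerivAt W (2 * F t) t := fun t =>
    ((((hasDerivAt_id' t).mul (hFd t)).sub (hGd t)).const_mul (2:ℝ)).congr_deriv (by ring)
  have hFc : Continuous F := continuous_iff_continuousAt.2 fun t => (hFd t).continuousAt
  have hWc : Continuous W := continuous_iff_continuousAt.2 fun t => (hWd t).continuousAt
  have hF0 : F 0 = 0 := by simp [hF]
  have hW0 : W 0 = 0 := by simp [hW, hG]
  -- bounds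
  have hFb : ∀ t : ℝ, 0 ≤ t → |F t| ≤ M * t ^ 1 := fun t ht => by
    have h := norm_integral_le_of_norm_le_const (a := (0:ℝ)) (b := t) (C := M) (f := C)
      fun x _ => by rw [Real.norm_eq_abs]; exact hM x
    rw [Real.norm_eq_abs, sub_zero, abs_of_nonneg ht] at h
    simpa [pow_one] using h
  have hGb : ∀ t : ℝ, 0 ≤ t → |G t| ≤ M * t ^ 2 := fun t ht => by
    have h := norm_integral_le_of_norm_le_const (a := (0:ℝ)) (b := t) (C := t * M) (f := fun s => s * C s)
      fun x hx => by
        rw [uIoc_of_le ht] at hx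
        rw [Real.norm_eq_abs, abs_mul, abs_of_nonneg hx.1.le]
        exact mul_le_mul hx.2 (hM x) (abs_nonneg _) ht
    rw [Real.norm_eq_abs, sub_zero, abs_of_nonneg ht] at h
    calc |G t| ≤ t * M * t := h
      _ = M * t ^ 2 := by ring
  have hWb : ∀ t : ℝ, 0 ≤ t → |W t| ≤ 4 * M * t ^ 2 := fun t ht => by
    have h1 := hFb t ht
    have h2 := hGb t ht
    rw [pow_one] at h1
    have h3 : |t * F t - G t| ≤ t * (M * t) + M * t ^ 2 := by
      refine (abs_sub _ _).trans (add_le_add ?_ h2)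
      rw [abs_mul, abs_of_nonneg ht]
      exact mul_le_mul_of_nonneg_left h1 ht
    show |2 * (t * F t - G t)| ≤ 4 * M * t ^ 2
    rw [abs_mul, abs_of_pos (by norm_num : (0:ℝ) < 2)]
    nlinarith
  have hCb : ∀ t : ℝ, 0 ≤ t → |C t| ≤ M * t ^ 0 := fun t _ => by simpa using hM t
  have h2Fb : ∀ t : ℝ, 0 ≤ t → |2 * F t| ≤ 2 * M * t ^ 1 := fun t ht => by
    rw [abs_mul, abs_of_pos (by norm_num : (0:ℝ) < 2)]
    have := hFb t ht
    nlinarith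
  -- `V = W` on `(0, ∞)`
  have hVW : ∀ t : ℝ, 0 ≤ t → V t = W t := fun t ht => by
    subst hV
    show 2 * ∫ s in Set.Ioc (0:ℝ) t, (t - s) * C s = 2 * (t * F t - G t)
    congr 1
    rw [← integral_of_le ht]
    have e : (fun s : ℝ => (t - s) * C s) = fun s => t * C s - s * C s := funext fun s => by ring
    rw [e, integral_sub ((hC.const_mul t).intervalIntegrable _ _) (hsC.intervalIntegrable _ _),
      intervalIntegral.integral_const_mul]
  have hVWon : EqOn (fun t : ℝ => Real.exp (-(ν * t)) * V t) (fun t : ℝ => Real.exp (-(ν * t)) * W t) (Ioi 0) :=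
    fun t ht => by simp only [hVW t (le_of_lt ht)]
  -- integrability of all the Laplace integrands
  have hiC : IntegrableOn (fun t : ℝ => Real.exp (-(ν * t)) * C t) (Ioi 0) :=
    integrableOn_exp_neg_mul_of_abs_le_pow hC hCb hν
  have hiF : IntegrableOn (fun t : ℝ => Real.exp (-(ν * t)) * F t) (Ioi 0) :=
    integrableOn_exp_neg_mul_of_abs_le_pow hFc hFb hν
  have hi2F : IntegrableOn (fun t : ℝ => Real.exp (-(ν * t)) * (2 * F t)) (Ioi 0) :=
    integrableOn_exp_neg_mul_of_abs_le_pow (continuous_const.mul hFc) h2Fb hν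
  have hiW : IntegrableOn (fun t : ℝ => Real.exp (-(ν * t)) * W t) (Ioi 0) :=
    integrableOn_exp_neg_mul_of_abs_le_pow hWc hWb hν
  have hiV : IntegrableOn (fun t : ℝ => Real.exp (-(ν * t)) * V t) (Ioi 0) :=
    hiW.congr_fun hVWon.symm measurableSet_Ioi
  -- first integration by parts: `∫ e^{-νt} C = ν ∫ e^{-νt} F`
  have ibp1 : ∫ t in Ioi (0:ℝ), Real.exp (-(ν * t)) * C t =
      0 - 0 - ∫ t in Ioi (0:ℝ), (-ν * Real.exp (-(ν * t))) * F t := by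
    refine integral_Ioi_mul_deriv_eq_deriv_mul (u := fun t => Real.exp (-(ν * t)))
      (u' := fun t => -ν * Real.exp (-(ν * t))) (v := F) (v' := C)
      (fun t _ => hasDerivAt_exp_neg_mul ν t) (fun t _ => hFd t) hiC ?_ ?_ ?_
    · have e : (fun t => -ν * Real.exp (-(ν * t))) * F = fun t => -ν * (Real.exp (-(ν * t)) * F t) :=
        funext fun t => by simp only [Pi.mul_apply]; ring
      rw [e]
      exact hiF.const_mul _
    · have h : Tendsto (fun t : ℝ => Real.exp (-(ν * t)) * F t) (𝓝[>] 0) (𝓝 (Real.exp (-(ν * 0)) * F 0)) :=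
        ((Continuous.mul (by fun_prop) hFc : Continuous fun t : ℝ => Real.exp (-(ν * t)) * F t).tendsto 0).mono_left
          nhdsWithin_le_nhds
      simpa [hF0, Pi.mul_def] using h
    · exact tendsto_exp_neg_mul_mul_atTop hFb hν
  -- second integration by parts: `∫ e^{-νt} (2F) = ν ∫ e^{-νt} W`
  have ibp2 : ∫ t in Ioi (0:ℝ), Real.exp (-(ν * t)) * (2 * F t) =
      0 - 0 - ∫ t in Ioi (0:ℝ), (-ν * Real.exp (-(ν * t))) * W t := by
    refine integral_Ioi_mul_deriv_eq_deriv_mul (u := fun t => Real.exp (-(ν * t)))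
      (u' := fun t => -ν * Real.exp (-(ν * t))) (v := W) (v' := fun t => 2 * F t)
      (fun t _ => hasDerivAt_exp_neg_mul ν t) (fun t _ => hWd t) hi2F ?_ ?_ ?_
    · have e : (fun t => -ν * Real.exp (-(ν * t))) * W = fun t => -ν * (Real.exp (-(ν * t)) * W t) :=
        funext fun t => by simp only [Pi.mul_apply]; ring
      rw [e]
      exact hiW.const_mul _
    · have h : Tendsto (fun t : ℝ => Real.exp (-(ν * t)) * W t) (𝓝[>] 0) (𝓝 (Real.exp (-(ν * 0)) * W 0)) :=
        ((Continuous.mul (by fun_prop) hWc : Continuous fun t : ℝ => Real.exp (-(ν * t)) * W t).tendsto 0).mono_left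
          nhdsWithin_le_nhds
      simpa [hW0, Pi.mul_def] using h
    · exact tendsto_exp_neg_mul_mul_atTop hWb hν
  -- linear algebra of the two identities
  have e1 : ∫ t in Ioi (0:ℝ), (-ν * Real.exp (-(ν * t))) * F t =
      -ν * ∫ t in Ioi (0:ℝ), Real.exp (-(ν * t)) * F t := by
    rw [← MeasureTheory.integral_const_mul]
    refine integral_congr_ae (Eventually.of_forall fun t => ?_)
    ring
  have e2 : ∫ t in Ioi (0:ℝ), (-ν * Real.exp (-(ν * t))) * W t =
      -ν * ∫ t in Ioi (0:ℝ), Real.exp (-(ν * t)) * W t := by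
    rw [← MeasureTheory.integral_const_mul]
    refine integral_congr_ae (Eventually.of_forall fun t => ?_)
    ring
  have e3 : ∫ t in Ioi (0:ℝ), Real.exp (-(ν * t)) * (2 * F t) =
      2 * ∫ t in Ioi (0:ℝ), Real.exp (-(ν * t)) * F t := by
    rw [← MeasureTheory.integral_const_mul]
    refine integral_congr_ae (Eventually.of_forall fun t => ?_)
    ring
  have e4 : ∫ t in Ioi (0:ℝ), Real.exp (-(ν * t)) * V t = ∫ t in Ioi (0:ℝ), Real.exp (-(ν * t)) * W t :=
    setIntegral_congr_fun measurableSet_Ioi hVWon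
  refine ⟨hiC, hiV, ?_⟩
  rw [e1] at ibp1
  rw [e2, e3] at ibp2
  rw [e4]
  -- ibp1: ∫C = ν ∫F ; ibp2: 2∫F = ν ∫W
  have h1 : ∫ t in Ioi (0:ℝ), Real.exp (-(ν * t)) * C t = ν * ∫ t in Ioi (0:ℝ), Real.exp (-(ν * t)) * F t := by
    rw [ibp1]; ring
  have h2 : 2 * ∫ t in Ioi (0:ℝ), Real.exp (-(ν * t)) * F t = ν * ∫ t in Ioi (0:ℝ), Real.exp (-(ν * t)) * W t := by
    rw [ibp2]; ring
  calc ∫ t in Ioi (0:ℝ), Real.exp (-(ν * t)) * C t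
      = ν / 2 * (2 * ∫ t in Ioi (0:ℝ), Real.exp (-(ν * t)) * F t) := by rw [h1]; ring
    _ = ν / 2 * (ν * ∫ t in Ioi (0:ℝ), Real.exp (-(ν * t)) * W t) := by rw [h2]
    _ = ν ^ 2 / 2 * ∫ t in Ioi (0:ℝ), Real.exp (-(ν * t)) * W t := by ring


/-! ## §2 The canonical clustering majorant -/

/-- **Stub 1 of line `canonical-rigidity`, proved**: locally-uniform-in-time summable clustering of the
current pair correlations for the canonical Buttà–Marchioro dynamics of the pinned chain in its
shift-invariant DLR state. [folklore] -/
theorem canonicalClusteringMajorant :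
    ∀ ω₂ lam β γ : ℝ, 0 < ω₂ → 0 < lam → 0 < β → ∀ T : ℝ, 0 < T →
    ∀ μ : MeasureTheory.Measure Literature.MathematicalPhysics.KineticTheory.HeatConduction.ChainConfig,
    (Literature.MathematicalPhysics.KineticTheory.HeatConduction.pinnedChain ω₂ lam β γ).IsChainGibbsMeasure T μ →
    Literature.MathematicalPhysics.KineticTheory.HeatConduction.IsShiftInvariant μ →
    μ.map (fun σ : Literature.MathematicalPhysics.KineticTheory.HeatConduction.ChainConfig => fun x : ℤ => ((σ x).1, -(σ x).2)) = μ →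
    ∀ D : Literature.MathematicalPhysics.KineticTheory.HeatConduction.InfiniteChainDynamics (Literature.MathematicalPhysics.KineticTheory.HeatConduction.pinnedChain ω₂ lam β γ),
    D.carrier = (Literature.MathematicalPhysics.KineticTheory.HeatConduction.pinnedChain ω₂ lam β γ).bmGood →
    (∀ t : ℝ, Measurable (D.flow t)) →
    (∀ t : ℝ, ∀ σ ∉ (Literature.MathematicalPhysics.KineticTheory.HeatConduction.pinnedChain ω₂ lam β γ).bmGood, D.flow t σ = σ) →
    ∀ τ : ℝ, ∃ m : ℤ → ℝ, Summable m ∧ ∀ t : ℝ, |t| ≤ τ → ∀ x : ℤ,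
      |∫ σ, (Literature.MathematicalPhysics.KineticTheory.HeatConduction.pinnedChain ω₂ lam β γ).bondCurrentZ σ 0 *
          (Literature.MathematicalPhysics.KineticTheory.HeatConduction.pinnedChain ω₂ lam β γ).bondCurrentZ (D.flow t σ) x ∂μ| ≤ m x := by
  intro ω₂ lam β γ hω hl hβ T hT μ hG hSI _hRefl D hcar hmeas hid τ
  -- the chain data: `U`, `V` even non-negative quartic polynomials, `C²`, condition B1
  have hU1 : OscillatorChain.IsEvenPolyOfDegree (pinnedChain ω₂ lam β γ).U 2 :=
    OscillatorChain.pinnedChain_isEvenPolyOfDegree_U β γ hω.le hl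
  have hV1 : OscillatorChain.IsEvenPolyOfDegree (pinnedChain ω₂ lam β γ).V 2 :=
    OscillatorChain.pinnedChain_isEvenPolyOfDegree_V ω₂ lam γ hβ
  have hU0 : ∀ r, 0 ≤ (pinnedChain ω₂ lam β γ).U r :=
    OscillatorChain.pinnedChain_U_nonneg β γ hω.le hl.le
  have hV0 : ∀ r, 0 ≤ (pinnedChain ω₂ lam β γ).V r := hV1.choose_spec.2.2
  have hU : ContDiff ℝ 2 (pinnedChain ω₂ lam β γ).U := hU1.contDiff_two
  have hV : ContDiff ℝ 2 (pinnedChain ω₂ lam β γ).V := hV1.contDiff_two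
  have hUm : Measurable (pinnedChain ω₂ lam β γ).U := hU.continuous.measurable
  have hB1 : (pinnedChain ω₂ lam β γ).CondB1 :=
    OscillatorChain.condB1_of_bddBelow _ hU hV ⟨0, by rintro _ ⟨q, rfl⟩; exact hU0 q⟩
      ⟨0, by rintro _ ⟨r, rfl⟩; exact hV0 r⟩
  -- (M): the given shift-invariant DLR state IS the mixing transfer-operator state (uniqueness)
  obtain ⟨μ', hG', hS', hss', -, C, m, hm, hmix⟩ :=
    Summit.AtomisticToContinuum.FouriersLaw.Theorems.MourreDissolution.exists_gibbsState_mixing_pinnedChain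
      ω₂ lam β γ hω hl.le hβ.le T hT
  have hμμ' : μ = μ' :=
    OscillatorChain.eq_of_isChainGibbsMeasure_of_isShiftInvariant_pinnedChain γ hω hl.le hβ.le hT hG hSI hG' hS'
  subst hμμ'
  have hss : (pinnedChain ω₂ lam β γ).HasSuperstabilityEstimate μ := hss'
  haveI : IsProbabilityMeasure μ := hss.1
  -- `μ` is invariant under the flow of `D` and under the severed box flows; translations preserve `μ`
  have hD : D.PreservesMeasure μ :=
    OscillatorChain.preservesMeasure_of_carrier_eq_bmGood (by norm_num) (by norm_num) hU1 hV1 D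
      hcar hmeas hG hss
  have hsev : ∀ (n : ℕ) (t : ℝ), MeasurePreserving
      (OscillatorChain.severedFlow hB1 (Finset.Icc ((0 : ℤ) - n) ((0 : ℤ) + n)) t) μ μ := fun n t =>
    OscillatorChain.measurePreserving_severedFlow_of_isChainGibbsMeasure hU hV hB1 _ hG t
  have hτ : ∀ x : ℤ, MeasurePreserving (chainShift x) μ μ := hSI.measurePreserving_chainShift
  -- the flow commutes with the translations everywhere
  have hφ : ∀ (t : ℝ) (x : ℤ), D.flow t ∘ chainShift x = chainShift x ∘ D.flow t := fun t x =>
    funext fun σ => D.flow_chainShift_of_eq_id hcar hid hU0 hV0 t x σ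
  -- the mixing constant may be taken non-negative
  have hmix' : ∀ (a : ℤ) (n : ℕ) (f g : ChainConfig → ℝ),
      DependsOn f {i : ℤ | i ≤ a} → DependsOn g {i : ℤ | a + n ≤ i} → Measurable f → Measurable g →
      MemLp f 2 μ → MemLp g 2 μ →
      |∫ σ, f σ * g σ ∂μ - (∫ σ, f σ ∂μ) * ∫ σ, g σ ∂μ| ≤
        max C 0 * Real.exp (-(m * n)) * (∫ σ, f σ ^ 2 ∂μ) ^ (1 / 2 : ℝ) *
          (∫ σ, g σ ^ 2 ∂μ) ^ (1 / 2 : ℝ) := by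
    intro a n f g h1 h2 h3 h4 h5 h6
    refine (hmix a n f g h1 h2 h3 h4 h5 h6).trans ?_
    have hA : 0 ≤ (∫ σ, f σ ^ 2 ∂μ) ^ (1 / 2 : ℝ) :=
      Real.rpow_nonneg (integral_nonneg fun _ => sq_nonneg _) _
    have hB : 0 ≤ (∫ σ, g σ ^ 2 ∂μ) ^ (1 / 2 : ℝ) :=
      Real.rpow_nonneg (integral_nonneg fun _ => sq_nonneg _) _
    have hE : 0 ≤ Real.exp (-(m * n)) := Real.exp_nonneg _
    have : C * Real.exp (-(m * n)) ≤ max C 0 * Real.exp (-(m * n)) :=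
      mul_le_mul_of_nonneg_right (le_max_left _ _) hE
    exact mul_le_mul_of_nonneg_right (mul_le_mul_of_nonneg_right this hA) hB
  have hC : 0 ≤ max C 0 := le_max_right _ _
  -- the generator `a = j₀`: measurable, local, in `L²` and `L⁴`, polynomially Lipschitz
  set a : ChainConfig → ℝ := fun σ => (pinnedChain ω₂ lam β γ).bondCurrentZ σ 0 with ha_def
  have ham : Measurable a := measurable_bondCurrentZ _ 0
  have had : DependsOn a (Icc (-1 : ℤ) 1) := OscillatorChain.dependsOn_bondCurrentZ_zero _
  have ha2 : MemLp a 2 μ := hss.memLp_bondCurrentZ (by norm_num) hU0 hUm hV1 0 ENNReal.ofNat_ne_top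
  have ha4' : MemLp a 4 μ := hss.memLp_bondCurrentZ (by norm_num) hU0 hUm hV1 0 ENNReal.ofNat_ne_top
  have ha4 : Integrable (fun σ => a σ ^ 4) μ := by
    have h := ha4'.integrable_norm_pow' (p := 4)
    refine h.congr (Eventually.of_forall fun σ => ?_)
    simp only [Real.norm_eq_abs]
    exact Even.pow_abs (by decide) _
  obtain ⟨Ca, hCa, hL⟩ := OscillatorChain.exists_polyLipschitz_bondCurrentZ hV1
  -- (L): `L²`-locality of `a ∘ φ_t`, uniformly on the window `|t| ≤ max τ 0`, summable rate
  have hloc : ∃ ε : ℕ → ℝ, (∀ n, 0 ≤ ε n) ∧ Summable ε ∧ ∀ t : ℝ, |t| ≤ max τ 0 → ∀ n : ℕ,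
      ∃ g : ChainConfig → ℝ, DependsOn g (Icc (-(n : ℤ) - 1) (n + 1)) ∧ Measurable g ∧
        MemLp g 2 μ ∧ Real.sqrt (∫ σ, (a (D.flow t σ) - g σ) ^ 2 ∂μ) ≤ ε n := by
    obtain ⟨ε, hε0, hε, hmain⟩ := D.exists_summable_l2_locality (by norm_num) (by norm_num) hU1 hV1
      hcar hB1 hss hD hsev ham had ha2 ha4 hCa hL (max τ 0) (le_max_right _ _)
    refine ⟨ε, hε0, hε, fun t ht n => ?_⟩
    obtain ⟨h1, h2, h3, h4⟩ := hmain t ht n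
    exact ⟨_, h1, h2, h3, h4⟩
  -- (T): ONE summable majorant of `|Cov(a, (a ∘ φ_t) ∘ τ_x)|` for all `|t| ≤ max τ 0`
  obtain ⟨F, hF, hb⟩ := D.exists_summable_majorant_cov_flow hτ hD hC hm hmix' ham had ha2 hloc
  -- mean zero of the current in a DLR state
  have hmean : ∫ σ, a σ ∂μ = 0 := hG.integral_bondCurrentZ_eq_zero 0
  refine ⟨F, hF, fun t ht x => ?_⟩
  have ht' : |t| ≤ max τ 0 := ht.trans (le_max_left _ _)
  have hY2 : MemLp ((a ∘ D.flow t) ∘ chainShift x) 2 μ :=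
    (ha2.comp_measurePreserving (hD.2 t)).comp_measurePreserving (hτ x)
  have hcov : cov[a, (a ∘ D.flow t) ∘ chainShift x; μ] =
      ∫ σ, (pinnedChain ω₂ lam β γ).bondCurrentZ σ 0 *
        (pinnedChain ω₂ lam β γ).bondCurrentZ (D.flow t σ) x ∂μ := by
    rw [covariance_eq_sub ha2 hY2, hmean, zero_mul, sub_zero]
    refine integral_congr_ae (Eventually.of_forall fun σ => ?_)
    simp only [Pi.mul_apply, comp_apply, ha_def]
    rw [show D.flow t (chainShift x σ) = chainShift x (D.flow t σ) from congrFun (hφ t x) σ,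
      OscillatorChain.bondCurrentZ_chainShift, zero_add]
  rw [← hcov]
  exact hb t ht' x


/-! ## Dynamics rigidity (PROVED): every guarded dynamics is the canonical one, a.e., at all times -/

/-- **Dynamics rigidity.** For the pinned chain (`ω₂, lam, β > 0`), a shift-invariant DLR state `μ`
at `T > 0`, ANY dynamics `D` preserving `μ` and ANY dynamics `D'` whose carrier is BM's good set:
`μ`-a.e. orbit of `D` is the orbit of `D'`, simultaneously for all times. (Superstability of the
shift-invariant state; sup-in-time BM (2.6) `ae_forall_flow_mem_bmGood_pinnedChain`; the uniqueness
field of `D'`.) No shift covariance and no momentum-reversal invariance is used. [folklore] -/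
theorem flow_ae_eq_canonical {ω₂ lam β : ℝ} (γ : ℝ) (hω : 0 < ω₂) (hl : 0 < lam) (hβ : 0 < β)
    {T : ℝ} (hT : 0 < T) {μ : Measure ChainConfig}
    (hG : (pinnedChain ω₂ lam β γ).IsChainGibbsMeasure T μ) (hSI : IsShiftInvariant μ)
    (D D' : InfiniteChainDynamics (pinnedChain ω₂ lam β γ)) (hP : D.PreservesMeasure μ)
    (hcar : D'.carrier = (pinnedChain ω₂ lam β γ).bmGood) :
    ∀ᵐ σ ∂μ, ∀ t : ℝ, D.flow t σ = D'.flow t σ := by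
  have hss : (pinnedChain ω₂ lam β γ).HasSuperstabilityEstimate μ :=
    OscillatorChain.hasSuperstabilityEstimate_of_isShiftInvariant_pinnedChain γ hω hl.le hβ.le hT hG hSI
  have hgood := OscillatorChain.ae_forall_flow_mem_bmGood_pinnedChain γ hω.le hl hβ hss D hP
  filter_upwards [hP.1, hgood] with σ hσ hσgood t
  have h := D'.unique (fun u => D.flow u σ) (fun u => by rw [hcar]; exact hσgood u)
    (D.isSolution σ hσ) t
  simpa only [D.flow_zero σ hσ] using h

/-! ## The canonical reduction (composition) -/

/-- **The line as one proposition**: `stub₁-sig → stub₂-sig → HeatVarianceCalculus` (wrapped in a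
`def` so that the skeleton audit sees exactly ONE theorem concluding the crux by name). [folklore] -/
def CanonicalReduction : Prop :=
    (∀ ω₂ lam β γ : ℝ, 0 < ω₂ → 0 < lam → 0 < β → ∀ T : ℝ, 0 < T →
    ∀ μ : MeasureTheory.Measure Literature.MathematicalPhysics.KineticTheory.HeatConduction.ChainConfig,
    (Literature.MathematicalPhysics.KineticTheory.HeatConduction.pinnedChain ω₂ lam β γ).IsChainGibbsMeasure T μ →
    Literature.MathematicalPhysics.KineticTheory.HeatConduction.IsShiftInvariant μ →
    μ.map (fun σ : Literature.MathematicalPhysics.KineticTheory.HeatConduction.ChainConfig => fun x : ℤ => ((σ x).1, -(σ x).2)) = μ →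
    ∀ D : Literature.MathematicalPhysics.KineticTheory.HeatConduction.InfiniteChainDynamics (Literature.MathematicalPhysics.KineticTheory.HeatConduction.pinnedChain ω₂ lam β γ),
    D.carrier = (Literature.MathematicalPhysics.KineticTheory.HeatConduction.pinnedChain ω₂ lam β γ).bmGood →
    (∀ t : ℝ, Measurable (D.flow t)) →
    (∀ t : ℝ, ∀ σ ∉ (Literature.MathematicalPhysics.KineticTheory.HeatConduction.pinnedChain ω₂ lam β γ).bmGood, D.flow t σ = σ) →
    ∀ τ : ℝ, ∃ m : ℤ → ℝ, Summable m ∧ ∀ t : ℝ, |t| ≤ τ → ∀ x : ℤ,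
      |∫ σ, (Literature.MathematicalPhysics.KineticTheory.HeatConduction.pinnedChain ω₂ lam β γ).bondCurrentZ σ 0 *
          (Literature.MathematicalPhysics.KineticTheory.HeatConduction.pinnedChain ω₂ lam β γ).bondCurrentZ (D.flow t σ) x ∂μ| ≤ m x) →
    (∀ C : ℝ → ℝ, Continuous C → (∃ M : ℝ, ∀ t : ℝ, |C t| ≤ M) → ∀ V : ℝ → ℝ,
    V = (fun τ : ℝ => 2 * ∫ s in Set.Ioc (0:ℝ) τ, (τ - s) * C s) → ∀ ν : ℝ, 0 < ν →
    MeasureTheory.IntegrableOn (fun t : ℝ => Real.exp (-(ν * t)) * C t) (Set.Ioi 0) ∧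
    MeasureTheory.IntegrableOn (fun t : ℝ => Real.exp (-(ν * t)) * V t) (Set.Ioi 0) ∧
    ∫ t in Set.Ioi (0:ℝ), Real.exp (-(ν * t)) * C t =
      ν ^ 2 / 2 * ∫ t in Set.Ioi (0:ℝ), Real.exp (-(ν * t)) * V t) →
    Summit.AtomisticToContinuum.FouriersLaw.Theses.CageBudgetFekete.HeatVarianceCalculus

/-- **Composition, hypothesis form (kernel-checked): the two stub STATEMENTS give the crux
`HeatVarianceCalculus` for EVERY guarded pair.** Rigidity (`flow_ae_eq_canonical`) makes every
correlation term of the guarded `D` equal to the corresponding term of the canonical `D♭` of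
`exists_bmDynamics`; (a) absolute convergence from the majorant of Stub 1 at the window `τ = |t|` and
the in-tree integrability of the terms; (b) continuity of `C_T = Σ_x c_x` by the Weierstrass M-test on
open windows, each `c_x` continuous in tree; (c) `V_T ≥ 0` and `|C_T| ≤ C_T(0)` from the in-tree positive
type of `D♭` (carrier `⊆ bmGood`); (d) the Laplace clauses from Stub 2 with `M = C_T(0)`. [folklore] -/
theorem heatVarianceCalculus_of_reduction : CanonicalReduction := by
  intro h1 h3 ω₂ lam β γ hω hl hβ T hT μ hG hSI hRefl D hP hShift
  -- superstability of the shift-invariant Gibbs state and the polynomial data of the chain (in tree)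
  have hss : (pinnedChain ω₂ lam β γ).HasSuperstabilityEstimate μ :=
    OscillatorChain.hasSuperstabilityEstimate_of_isShiftInvariant_pinnedChain γ hω hl.le hβ.le hT hG hSI
  have hU0 : ∀ q : ℝ, 0 ≤ (pinnedChain ω₂ lam β γ).U q :=
    OscillatorChain.pinnedChain_U_nonneg β γ hω.le hl.le
  have hUm : Measurable (pinnedChain ω₂ lam β γ).U := OscillatorChain.measurable_pinnedChain_U ω₂ lam β γ
  have hU2 : OscillatorChain.IsEvenPolyOfDegree (pinnedChain ω₂ lam β γ).U 2 :=
    OscillatorChain.pinnedChain_isEvenPolyOfDegree_U β γ hω.le hl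
  have hV2 : OscillatorChain.IsEvenPolyOfDegree (pinnedChain ω₂ lam β γ).V 2 :=
    OscillatorChain.pinnedChain_isEvenPolyOfDegree_V ω₂ lam γ hβ
  -- the canonical Buttà–Marchioro dynamics `D♭` (carrier `bmGood`, measurable flow, identity off `bmGood`)
  obtain ⟨D', hcar, hmeas, hid, -, -, -, hpresAll⟩ :=
    OscillatorChain.exists_bmDynamics (P := pinnedChain ω₂ lam β γ) one_le_two one_le_two hU2 hV2
  have hP' : D'.PreservesMeasure μ := hpresAll T μ hG hss
  -- RIGIDITY: the guarded `D` is `D♭` a.e., at all times; hence every correlation term agrees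
  have hrig := flow_ae_eq_canonical γ hω hl hβ hT hG hSI D D' hP hcar
  have hterm : ∀ (t : ℝ) (x : ℤ),
      ∫ σ, (pinnedChain ω₂ lam β γ).bondCurrentZ σ 0 *
          (pinnedChain ω₂ lam β γ).bondCurrentZ (D.flow t σ) x ∂μ =
        ∫ σ, (pinnedChain ω₂ lam β γ).bondCurrentZ σ 0 *
          (pinnedChain ω₂ lam β γ).bondCurrentZ (D'.flow t σ) x ∂μ := fun t x => by
    refine integral_congr_ae ?_
    filter_upwards [hrig] with σ hσ
    rw [hσ t]
  have hCC' : ∀ t : ℝ, D.currentCorrelation μ t = D'.currentCorrelation μ t := fun t => by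
    unfold InfiniteChainDynamics.currentCorrelation
    exact tsum_congr fun x => hterm t x
  have hCfun : (fun t : ℝ => D.currentCorrelation μ t) = fun t : ℝ => D'.currentCorrelation μ t :=
    funext hCC'
  -- the terms: integrable integrands (both dynamics) and continuity in `t` (canonical dynamics), in tree
  have hint : ∀ (t : ℝ) (x : ℤ), Integrable (fun σ =>
      (pinnedChain ω₂ lam β γ).bondCurrentZ σ 0 *
        (pinnedChain ω₂ lam β γ).bondCurrentZ (D.flow t σ) x) μ := fun t x =>
    hss.integrable_bondCurrentZ_mul_comp one_le_two hU0 hUm hV2 (hP.2 t) x 0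
  have hint' : ∀ (t : ℝ) (x : ℤ), Integrable (fun σ =>
      (pinnedChain ω₂ lam β γ).bondCurrentZ σ 0 *
        (pinnedChain ω₂ lam β γ).bondCurrentZ (D'.flow t σ) x) μ := fun t x =>
    hss.integrable_bondCurrentZ_mul_comp one_le_two hU0 hUm hV2 (hP'.2 t) x 0
  have hcont' : ∀ x : ℤ, Continuous fun t : ℝ =>
      ∫ σ, (pinnedChain ω₂ lam β γ).bondCurrentZ σ 0 *
        (pinnedChain ω₂ lam β γ).bondCurrentZ (D'.flow t σ) x ∂μ := fun x =>
    InfiniteChainDynamics.continuous_integral_bondCurrentZ_mul_flow_pinnedChain γ hω.le hl.le hβ hss D' hP' x 0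
  -- Stub 1 for the canonical pair
  have h1' := h1 ω₂ lam β γ hω hl hβ T hT μ hG hSI hRefl D' hcar hmeas hid
  -- (a) absolute convergence at every time, for `D♭` and (by rigidity) for `D`
  have hAC' : ∀ t : ℝ, D'.HasAbsConvergentCorrelation μ t := fun t => by
    obtain ⟨m, hm, hb⟩ := h1' |t|
    exact ⟨fun x => hint' t x,
      Summable.of_nonneg_of_le (fun x => abs_nonneg _) (fun x => hb t le_rfl x) hm⟩
  have hAC : ∀ t : ℝ, D.HasAbsConvergentCorrelation μ t := fun t => by
    obtain ⟨m, hm, hb⟩ := h1' |t|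
    refine ⟨fun x => hint t x, Summable.of_nonneg_of_le (fun x => abs_nonneg _) (fun x => ?_) hm⟩
    rw [hterm t x]
    exact hb t le_rfl x
  -- (b) continuity of `C_T` (for `D♭`, by the Weierstrass M-test on open windows; `C_T` of `D` is the same function)
  have hC' : Continuous fun t : ℝ => D'.currentCorrelation μ t := by
    refine continuous_iff_continuousAt.2 fun t₀ => ?_
    obtain ⟨m, hm, hb⟩ := h1' (|t₀| + 1)
    have hon : ContinuousOn (fun t : ℝ => ∑' x : ℤ,
        ∫ σ, (pinnedChain ω₂ lam β γ).bondCurrentZ σ 0 *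
          (pinnedChain ω₂ lam β γ).bondCurrentZ (D'.flow t σ) x ∂μ)
        (Set.Ioo (-(|t₀| + 1)) (|t₀| + 1)) :=
      continuousOn_tsum (fun x => (hcont' x).continuousOn) hm fun x t ht => by
        rw [Real.norm_eq_abs]
        exact hb t (abs_le.2 ⟨ht.1.le, ht.2.le⟩) x
    exact hon.continuousAt
      (Ioo_mem_nhds (by linarith [neg_abs_le t₀]) (by linarith [le_abs_self t₀]))
  have hC : Continuous fun t : ℝ => D.currentCorrelation μ t := by rw [hCfun]; exact hC'
  -- (c) positive type of the canonical autocorrelation (carrier `= bmGood`), in tree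
  obtain ⟨-, hbd', hpos'⟩ :=
    D'.currentCorrelation_positiveType_of_carrier_subset_bmGood one_le_two one_le_two hU2 hV2 hss hSI
      hcar.le hP' hAC'
  have hbd : ∀ t : ℝ, |D.currentCorrelation μ t| ≤ D.currentCorrelation μ 0 := fun t => by
    rw [hCC' t, hCC' 0]; exact hbd' t
  refine ⟨hAC, hC, fun V hV => ⟨fun τ hτ => ?_, fun ν hν => ?_⟩⟩
  · subst hV
    dsimp only
    refine mul_nonneg zero_le_two ?_
    have e : (fun s : ℝ => (τ - s) * D.currentCorrelation μ s) =
        fun s : ℝ => (τ - s) * D'.currentCorrelation μ s := funext fun s => by rw [hCC' s]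
    rw [e]
    exact hpos' τ hτ
  · -- (d) the Laplace clauses from Stub 2 with `M = C_T(0)`
    exact h3 (fun t : ℝ => D.currentCorrelation μ t) hC ⟨D.currentCorrelation μ 0, hbd⟩ V hV ν hν


/-- **The route item `CageBudgetFekete.HeatVarianceCalculus`, proved** (closes stmt-AtomisticToContinuum-15772):
the canonical reduction applied to the canonical clustering majorant and the Laplace calculus. [folklore] -/
theorem heatVarianceCalculus :
    Summit.AtomisticToContinuum.FouriersLaw.Theses.CageBudgetFekete.HeatVarianceCalculus :=
  heatVarianceCalculus_of_reduction canonicalClusteringMajorant laplaceHeatVariance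

end Summit.AtomisticToContinuum.FouriersLaw.Theorems.CageBudgetFeketeHeatVarianceCalculus

end
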